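import Mathlib
import Summits.Ventures.HodgeRepro2.InvariantWedge
import Summits.Ventures.HodgeRepro2.InvariantFormsSpace

/-!
# Identity principle on the ball, by restriction to complex lines

Kernel annex of the blind cell `pub-hodge-repro2` (seat p2), Tier-3 hypothesis shapes of
`Hypothesis.lean`.  The non-vanishing condition `WedgeNonzero q₁ q₂` of `NonVanishingInput` (the
conclusion of Shimura's Thm 8.1 as instantiated in row 1) asks for ONE point of the ball at which
the coefficient `q₁ ∧ q₂` of the holomorphic 2-form is non-zero.  Since `IsHolomorphicOneForm`
only records ℂ-differentiability on the ball (and Mathlib has no several-variable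
«holomorphic ⇒ analytic» theorem), the identity principle needed to upgrade «non-zero somewhere»
to «non-zero on a dense open set» is proved here by RESTRICTION TO COMPLEX LINES: on a convex open
set `s`, a ℂ-differentiable `f` vanishing near one point vanishes on `s`, because along every
complex line through that point `f` is a one-variable holomorphic function on a convex (hence
connected) open subset of `ℂ`, where Mathlib's identity theorem applies.

* `eqOn_zero_of_differentiableOn_of_convex`, `eqOn_of_differentiableOn_of_convex`,
  `exists_ne_zero_of_differentiableOn_of_convex` (general, for any complex normed spaces);
* `convex_ball₂`, `isPreconnected_ball₂` (the ball is the Euclidean unit ball);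
* `differentiableOn_wedgeAt` and **`wedgeNonzero_iff_forall_isOpen`** /
  **`wedgeNonzero_iff_subset_closure`**: for holomorphic `q₁, q₂`, `WedgeNonzero q₁ q₂` holds iff
  `q₁ ∧ q₂` is non-zero on a dense subset of the ball — the weakest and the generic reading of
  the non-vanishing hypothesis coincide (and by `InvariantWedge.lean` the locus is `Γ`-stable).
-/

namespace Summit.Ventures.HodgeRepro2.ShimuraData

open Topology Filter Set

section general

variable {E F : Type*} [NormedAddCommGroup E] [NormedSpace ℂ E] [NormedAddCommGroup F]
  [NormedSpace ℂ F] [CompleteSpace F]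

/-- **Identity principle on a convex open set, by line restriction.** A ℂ-differentiable map
on a convex open set `s` that vanishes near a point of `s` vanishes on `s`. -/
theorem eqOn_zero_of_differentiableOn_of_convex {f : E → F} {s : Set E} (hs : IsOpen s)
    (hconv : Convex ℝ s) (hf : DifferentiableOn ℂ f s) {z₀ : E} (hz₀s : z₀ ∈ s)
    (hz₀ : f =ᶠ[𝓝 z₀] 0) : EqOn f 0 s := by
  intro w hw
  -- the complex line through `z₀` and `w`
  let L : ℂ → E := fun t => z₀ + t • (w - z₀)
  have hLc : Continuous L := continuous_const.add (continuous_id.smul continuous_const)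
  have hLd : Differentiable ℂ L := (differentiable_id.smul_const (w - z₀)).const_add z₀
  -- the (convex, open) parameter set of the line inside `s`
  have hTo : IsOpen (L ⁻¹' s) := hs.preimage hLc
  have hTc : Convex ℝ (L ⁻¹' s) := by
    have hlin : IsLinearMap ℝ fun t : ℂ => t • (w - z₀) :=
      ⟨fun x y => add_smul x y _, fun c x => smul_assoc c x _⟩
    have : L ⁻¹' s = (fun t : ℂ => t • (w - z₀)) ⁻¹' ((fun x => x + z₀) ⁻¹' s) := by
      ext t
      simp [L, add_comm]
    rw [this]
    exact (hconv.translate_preimage_left z₀).is_linear_preimage hlin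
  have h0 : (0 : ℂ) ∈ L ⁻¹' s := by simp [L, hz₀s]
  have h1 : (1 : ℂ) ∈ L ⁻¹' s := by simp [L, hw]
  -- the restriction of `f` to the line is a one-variable holomorphic function
  have hg : DifferentiableOn ℂ (f ∘ L) (L ⁻¹' s) :=
    hf.comp hLd.differentiableOn fun _ ht => ht
  have hga : AnalyticOnNhd ℂ (f ∘ L) (L ⁻¹' s) := hg.analyticOnNhd hTo
  have hg0 : (f ∘ L) =ᶠ[𝓝 0] 0 := by
    have hL0 : Tendsto L (𝓝 0) (𝓝 z₀) := by
      have := hLc.continuousAt (x := 0)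
      simpa [L, ContinuousAt] using this
    exact hz₀.comp_tendsto hL0
  have := hga.eqOn_zero_of_preconnected_of_eventuallyEq_zero hTc.isPreconnected h0 hg0 h1
  simpa [L] using this

/-- Two ℂ-differentiable maps on a convex open set that agree near a point agree everywhere. -/
theorem eqOn_of_differentiableOn_of_convex {f g : E → F} {s : Set E} (hs : IsOpen s)
    (hconv : Convex ℝ s) (hf : DifferentiableOn ℂ f s) (hg : DifferentiableOn ℂ g s) {z₀ : E}
    (hz₀s : z₀ ∈ s) (hz₀ : f =ᶠ[𝓝 z₀] g) : EqOn f g s := by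
  have h := eqOn_zero_of_differentiableOn_of_convex hs hconv (hf.sub hg) hz₀s
    (hz₀.mono fun z hz => by simp [hz])
  intro w hw
  exact sub_eq_zero.1 (h hw)

/-- A ℂ-differentiable map on a convex open set that is non-zero somewhere is non-zero on every
non-empty open subset: its non-vanishing locus is dense. -/
theorem exists_ne_zero_of_differentiableOn_of_convex {f : E → F} {s : Set E} (hs : IsOpen s)
    (hconv : Convex ℝ s) (hf : DifferentiableOn ℂ f s) (hne : ∃ z ∈ s, f z ≠ 0) {V : Set E}
    (hV : IsOpen V) (hVs : V ⊆ s) (hVne : V.Nonempty) : ∃ z ∈ V, f z ≠ 0 := by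
  by_contra h
  push Not at h
  obtain ⟨z₀, hz₀⟩ := hVne
  have hev : f =ᶠ[𝓝 z₀] 0 := by
    filter_upwards [hV.mem_nhds hz₀] with z hz
    exact h z hz
  obtain ⟨w, hw, hfw⟩ := hne
  exact hfw (eqOn_zero_of_differentiableOn_of_convex hs hconv hf (hVs hz₀) hev hw)

end general

/-- The ball is the preimage of the Euclidean unit ball of `ℂ²`. -/
theorem ball₂_eq_preimage_euclideanBall : ball₂ =
    (fun z : Fin 2 → ℂ => (WithLp.toLp 2 z : EuclideanSpace ℂ (Fin 2))) ⁻¹' Metric.ball 0 1 := by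
  ext z
  simp only [ball₂, Set.mem_setOf_eq, Set.mem_preimage, Metric.mem_ball, dist_zero_right,
    EuclideanSpace.norm_eq]
  rw [Real.sqrt_lt' one_pos, one_pow]

/-- The ball is convex. -/
theorem convex_ball₂ : Convex ℝ ball₂ := by
  rw [ball₂_eq_preimage_euclideanBall]
  exact (convex_ball (0 : EuclideanSpace ℂ (Fin 2)) 1).is_linear_preimage
    ⟨fun _ _ => rfl, fun _ _ => rfl⟩

/-- The ball is preconnected. -/
theorem isPreconnected_ball₂ : IsPreconnected ball₂ := convex_ball₂.isPreconnected

/-- The ball is connected. -/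
theorem isConnected_ball₂ : IsConnected ball₂ := ⟨⟨0, by simp [ball₂]⟩, isPreconnected_ball₂⟩

/-- Identity principle on the ball: a ℂ-differentiable map vanishing near a point of the ball
vanishes on the ball. -/
theorem eqOn_zero_ball₂_of_differentiableOn {F : Type*} [NormedAddCommGroup F] [NormedSpace ℂ F]
    [CompleteSpace F] {f : (Fin 2 → ℂ) → F} (hf : DifferentiableOn ℂ f ball₂) {z₀ : Fin 2 → ℂ}
    (hz₀s : z₀ ∈ ball₂) (hz₀ : f =ᶠ[𝓝 z₀] 0) : EqOn f 0 ball₂ :=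
  eqOn_zero_of_differentiableOn_of_convex isOpen_ball₂ convex_ball₂ hf hz₀s hz₀

/-- The wedge coefficient of two holomorphic 1-forms is ℂ-differentiable on the ball. -/
theorem differentiableOn_wedgeAt {q₁ q₂ : (Fin 2 → ℂ) → Fin 2 → ℂ} (h₁ : IsHolomorphicOneForm q₁)
    (h₂ : IsHolomorphicOneForm q₂) : DifferentiableOn ℂ (wedgeAt q₁ q₂) ball₂ := by
  intro z hz
  refine DifferentiableAt.differentiableWithinAt ?_
  exact ((h₁.differentiableAt_apply hz 0).mul (h₂.differentiableAt_apply hz 1)).sub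
    ((h₁.differentiableAt_apply hz 1).mul (h₂.differentiableAt_apply hz 0))

/-- **`WedgeNonzero` is generic non-vanishing**: for holomorphic `q₁, q₂`, the wedge is non-zero
at some point of the ball iff it is non-zero at some point of EVERY non-empty open subset of the
ball. -/
theorem wedgeNonzero_iff_forall_isOpen {q₁ q₂ : (Fin 2 → ℂ) → Fin 2 → ℂ}
    (h₁ : IsHolomorphicOneForm q₁) (h₂ : IsHolomorphicOneForm q₂) :
    WedgeNonzero q₁ q₂ ↔
      ∀ V : Set (Fin 2 → ℂ), IsOpen V → V ⊆ ball₂ → V.Nonempty → ∃ z ∈ V, wedgeAt q₁ q₂ z ≠ 0 := by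
  constructor
  · intro hne V hV hVs hVne
    exact exists_ne_zero_of_differentiableOn_of_convex isOpen_ball₂ convex_ball₂
      (differentiableOn_wedgeAt h₁ h₂) hne hV hVs hVne
  · intro h
    obtain ⟨z, hz, hne⟩ := h ball₂ isOpen_ball₂ subset_rfl ⟨0, by simp [ball₂]⟩
    exact ⟨z, hz, hne⟩

/-- **`WedgeNonzero` is generic non-vanishing**, closure form: for holomorphic `q₁, q₂`, the wedge
is non-zero somewhere iff the ball lies in the closure of the non-vanishing locus
`{z ∈ 𝔹² | q₁∧q₂ (z) ≠ 0}` (which is open and, for `Γ`-invariant forms, `Γ`-stable). -/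
theorem wedgeNonzero_iff_subset_closure {q₁ q₂ : (Fin 2 → ℂ) → Fin 2 → ℂ}
    (h₁ : IsHolomorphicOneForm q₁) (h₂ : IsHolomorphicOneForm q₂) :
    WedgeNonzero q₁ q₂ ↔ ball₂ ⊆ closure {z | z ∈ ball₂ ∧ wedgeAt q₁ q₂ z ≠ 0} := by
  rw [wedgeNonzero_iff_forall_isOpen h₁ h₂]
  constructor
  · intro h z hz
    rw [mem_closure_iff]
    intro o ho hzo
    obtain ⟨w, ⟨hwo, hwb⟩, hw⟩ := h (o ∩ ball₂) (ho.inter isOpen_ball₂) inter_subset_right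
      ⟨z, hzo, hz⟩
    exact ⟨w, hwo, hwb, hw⟩
  · intro h V hV hVs hVne
    obtain ⟨z, hz⟩ := hVne
    have := h (hVs hz)
    rw [mem_closure_iff] at this
    obtain ⟨w, hwV, -, hw⟩ := this V hV hz
    exact ⟨w, hwV, hw⟩

end Summit.Ventures.HodgeRepro2.ShimuraData
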